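import Mathlib
import Summits.Ventures.PercRepro2.Defs
import Summits.Ventures.PercRepro2.CoinTraceBlock
import Summits.Ventures.PercRepro2.CoinTraceShift

/-!
# The abstract pendant lemma for the 2-STAR trace family (blind cell PercRepro2, night-2 g3;
proofs/NIGHT2-DARC.md §17)

`P = {w, v₁, v₂}`, trace family `𝒵 = P.powerset`; a trace law `μ ≥ 0` on `𝒵` with `μ {w} = 0`
(the head `w` reaches `t` only through `v₁` or `v₂`), conditional means `x, y` (decreasing, `≤ 1`)
and pivotal means `x̂, ŷ` (decreasing, `≤ x`, equal to `x` off the pivotal family `{Z ∋ w}`),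
pivotal weights `ρ` (`= 1` off `{Z ∋ w}`, in `[0, 1]`, increasing from `{w, vᵢ}` to `P`), and
the two positive-association inputs of the trace law — (AV-PA) on every avoidance family
`{Z : Z ∩ U = ∅}` and (CU-PA) on the cylinder families `{Z ∋ vᵢ}` — for every pair of monotone
nonnegative functionals.  Then `S′ = Σ_Z μ_Z ρ_Z (x̂_Z Λ − MX)(ŷ_Z Λ − MY) ≥ 0`
(`twoStar_functional_nonneg`): Abel summation along `ρ` over the up-sets `∅ ⊂ {P} ⊂ {{w,vⱼ}, P} ⊂ 𝒰`
of the pivotal family (NIGHT2-DARC.md §15.3 (a)), each block handled by the sign method —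
(15.7) (a)–(c) and the single-vertex form (15.8) — through `block_nonneg`.
-/

namespace Summit.Ventures.PercRepro2.Coin


section TwoStar

open Classical

variable {V : Type*} [DecidableEq V] {R : Type*} [Field R] [LinearOrder R] [IsStrictOrderedRing R]

omit [LinearOrder R] [IsStrictOrderedRing R] in
/-- The pointwise Abel decomposition of the pivotal weight on the 2-star family
(case `ρ {w, v₁} ≤ ρ {w, v₂}`). -/
lemma twoStar_rho_decomp {w v₁ v₂ : V} (hwv₁ : w ≠ v₁) (hwv₂ : w ≠ v₂) (hv₁₂ : v₁ ≠ v₂)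
    (μ ρ : Finset V → R) (hμw : μ {w} = 0)
    (hρ1 : ∀ Z ∈ ({w, v₁, v₂} : Finset V).powerset, w ∉ Z → ρ Z = 1) {Z : Finset V}
    (hZ : Z ∈ ({w, v₁, v₂} : Finset V).powerset) :
    μ Z * ρ Z = μ Z * ((1 - ρ {w, v₁, v₂}) * (if Disjoint Z {w} then (1 : R) else 0)
      + (ρ {w, v₁, v₂} - ρ {w, v₂}) *
          (if Disjoint Z {w} ∨ (v₁ ∈ Z ∧ v₂ ∈ Z) then (1 : R) else 0)
      + (ρ {w, v₂} - ρ {w, v₁}) * (if Disjoint Z {w} ∨ v₂ ∈ Z then (1 : R) else 0)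
      + ρ {w, v₁}) := by
  have hZP : Z ⊆ {w, v₁, v₂} := Finset.mem_powerset.mp hZ
  by_cases hw : w ∈ Z
  · have hd : ¬ Disjoint Z {w} := fun h => Finset.disjoint_singleton_right.mp h hw
    by_cases hv₁ : v₁ ∈ Z <;> by_cases hv₂ : v₂ ∈ Z
    · -- `Z = P`
      have hZe : Z = {w, v₁, v₂} := by
        ext z
        constructor
        · exact fun h => hZP h
        · intro h
          simp only [Finset.mem_insert, Finset.mem_singleton] at h
          rcases h with rfl | rfl | rfl <;> assumption
      simp only [hd, hv₁, hv₂, and_self, or_true, if_true, if_false]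
      rw [hZe]
      ring
    · -- `Z = {w, v₁}`
      have hZe : Z = {w, v₁} := by
        ext z
        constructor
        · intro h
          have := hZP h
          simp only [Finset.mem_insert, Finset.mem_singleton] at this ⊢
          rcases this with rfl | rfl | rfl
          · exact Or.inl rfl
          · exact Or.inr rfl
          · exact absurd h hv₂
        · intro h
          simp only [Finset.mem_insert, Finset.mem_singleton] at h
          rcases h with rfl | rfl <;> assumption
      simp only [hd, hv₁, hv₂, and_false, or_false, if_false]
      rw [hZe]
      ring
    · -- `Z = {w, v₂}`
      have hZe : Z = {w, v₂} := by
        ext z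
        constructor
        · intro h
          have := hZP h
          simp only [Finset.mem_insert, Finset.mem_singleton] at this ⊢
          rcases this with rfl | rfl | rfl
          · exact Or.inl rfl
          · exact absurd h hv₁
          · exact Or.inr rfl
        · intro h
          simp only [Finset.mem_insert, Finset.mem_singleton] at h
          rcases h with rfl | rfl <;> assumption
      simp only [hd, hv₁, hv₂, false_and, or_false, if_false, or_true, if_true]
      rw [hZe]
      ring
    · -- `Z = {w}`: zero mass
      have hZe : Z = {w} := by
        ext z
        constructor
        · intro h
          have := hZP h
          simp only [Finset.mem_insert, Finset.mem_singleton] at this ⊢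
          rcases this with rfl | rfl | rfl
          · rfl
          · exact absurd h hv₁
          · exact absurd h hv₂
        · intro h
          rw [Finset.mem_singleton] at h
          rw [h]; exact hw
      rw [hZe, hμw]
      ring
  · have hd : Disjoint Z {w} := Finset.disjoint_singleton_right.mpr hw
    rw [hρ1 Z hZ hw]
    simp only [hd, true_or, if_true]
    ring


/-- **The abstract pendant lemma for the 2-star family, ordered case** `ρ {w, v₁} ≤ ρ {w, v₂}`:
`S′ = Σ_Z μ_Z ρ_Z (x̂_Z Λ − MX)(ŷ_Z Λ − MY) ≥ 0`. -/
theorem twoStar_core {w v₁ v₂ : V} (hwv₁ : w ≠ v₁) (hwv₂ : w ≠ v₂) (hv₁₂ : v₁ ≠ v₂)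
    (μ x y xh yh ρ : Finset V → R)
    (hμ : ∀ Z ∈ ({w, v₁, v₂} : Finset V).powerset, 0 ≤ μ Z) (hμw : μ {w} = 0)
    (hx1 : ∀ Z : Finset V, Z ⊆ ({w, v₁, v₂} : Finset V) → x Z ≤ 1) (hy1 : ∀ Z : Finset V, Z ⊆ ({w, v₁, v₂} : Finset V) → y Z ≤ 1)
    (hxh1 : ∀ Z : Finset V, Z ⊆ ({w, v₁, v₂} : Finset V) → xh Z ≤ 1) (hyh1 : ∀ Z : Finset V, Z ⊆ ({w, v₁, v₂} : Finset V) → yh Z ≤ 1)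
    (hxanti : ∀ Z Z' : Finset V, Z ⊆ Z' → Z' ⊆ ({w, v₁, v₂} : Finset V) → x Z' ≤ x Z)
    (hyanti : ∀ Z Z' : Finset V, Z ⊆ Z' → Z' ⊆ ({w, v₁, v₂} : Finset V) → y Z' ≤ y Z)
    (hxhanti : ∀ Z Z' : Finset V, Z ⊆ Z' → Z' ⊆ ({w, v₁, v₂} : Finset V) → xh Z' ≤ xh Z)
    (hyhanti : ∀ Z Z' : Finset V, Z ⊆ Z' → Z' ⊆ ({w, v₁, v₂} : Finset V) → yh Z' ≤ yh Z)
    (hxh_le : ∀ Z : Finset V, Z ⊆ ({w, v₁, v₂} : Finset V) → xh Z ≤ x Z) (hyh_le : ∀ Z : Finset V, Z ⊆ ({w, v₁, v₂} : Finset V) → yh Z ≤ y Z)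
    (hxh_eq : ∀ Z : Finset V, Z ⊆ ({w, v₁, v₂} : Finset V) → w ∉ Z → xh Z = x Z)
    (hyh_eq : ∀ Z : Finset V, Z ⊆ ({w, v₁, v₂} : Finset V) → w ∉ Z → yh Z = y Z)
    (hρ1 : ∀ Z ∈ ({w, v₁, v₂} : Finset V).powerset, w ∉ Z → ρ Z = 1) (hρ0 : 0 ≤ ρ {w, v₁}) (hρle : ρ ({w, v₁, v₂} : Finset V) ≤ 1)
    (hρ₂ : ρ {w, v₂} ≤ ρ ({w, v₁, v₂} : Finset V)) (hr : ρ {w, v₁} ≤ ρ {w, v₂})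
    (hPA : TracePA ({w, v₁, v₂} : Finset V) μ) (hCU : TraceCUPA ({w, v₁, v₂} : Finset V) μ v₂) :
    0 ≤ ∑ Z ∈ ({w, v₁, v₂} : Finset V).powerset, μ Z * ρ Z *
      (xh Z * (∑ Z' ∈ ({w, v₁, v₂} : Finset V).powerset, μ Z') - ∑ Z' ∈ ({w, v₁, v₂} : Finset V).powerset, x Z' * μ Z') *
      (yh Z * (∑ Z' ∈ ({w, v₁, v₂} : Finset V).powerset, μ Z') - ∑ Z' ∈ ({w, v₁, v₂} : Finset V).powerset, y Z' * μ Z') := by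
  obtain ⟨Λ, hΛ⟩ : ∃ L : R, L = ∑ Z ∈ ({w, v₁, v₂} : Finset V).powerset, μ Z := ⟨_, rfl⟩
  obtain ⟨MX, hMX⟩ : ∃ M : R, M = ∑ Z ∈ ({w, v₁, v₂} : Finset V).powerset, x Z * μ Z := ⟨_, rfl⟩
  obtain ⟨MY, hMY⟩ : ∃ M : R, M = ∑ Z ∈ ({w, v₁, v₂} : Finset V).powerset, y Z * μ Z := ⟨_, rfl⟩
  rw [← hΛ, ← hMX, ← hMY]
  have hΛn : 0 ≤ Λ := by rw [hΛ]; exact Finset.sum_nonneg hμ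
  have hwP : w ∈ ({w, v₁, v₂} : Finset V) := by simp
  have hv₁P : v₁ ∈ ({w, v₁, v₂} : Finset V) := by simp
  have hv₂P : v₂ ∈ ({w, v₁, v₂} : Finset V) := by simp
  -- monotone / nonnegative functionals
  have monX : ∀ Z Z' : Finset V, Z ⊆ Z' → Z' ⊆ ({w, v₁, v₂} : Finset V) → (fun Z => 1 - xh Z) Z ≤ (fun Z => 1 - xh Z) Z' :=
    fun Z Z' h h' => by show 1 - xh Z ≤ 1 - xh Z'; linarith [hxhanti Z Z' h h']
  have monY : ∀ Z Z' : Finset V, Z ⊆ Z' → Z' ⊆ ({w, v₁, v₂} : Finset V) → (fun Z => 1 - yh Z) Z ≤ (fun Z => 1 - yh Z) Z' :=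
    fun Z Z' h h' => by show 1 - yh Z ≤ 1 - yh Z'; linarith [hyhanti Z Z' h h']
  have nnX : ∀ Z : Finset V, Z ⊆ ({w, v₁, v₂} : Finset V) → 0 ≤ (fun Z => 1 - xh Z) Z :=
    fun Z h => by show 0 ≤ 1 - xh Z; linarith [hxh1 Z h]
  have nnY : ∀ Z : Finset V, Z ⊆ ({w, v₁, v₂} : Finset V) → 0 ≤ (fun Z => 1 - yh Z) Z :=
    fun Z h => by show 0 ≤ 1 - yh Z; linarith [hyh1 Z h]
  -- the top trace has nonpositive centred means
  have hxtop : xh ({w, v₁, v₂} : Finset V) * Λ - MX ≤ 0 := by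
    have h1 : x ({w, v₁, v₂} : Finset V) * Λ ≤ MX := by
      rw [hΛ, hMX, Finset.mul_sum]
      exact Finset.sum_le_sum fun Z hZ => mul_le_mul_of_nonneg_right
        (hxanti Z ({w, v₁, v₂} : Finset V) (Finset.mem_powerset.mp hZ) (subset_refl _)) (hμ Z hZ)
    have h2 : xh ({w, v₁, v₂} : Finset V) * Λ ≤ x ({w, v₁, v₂} : Finset V) * Λ :=
      mul_le_mul_of_nonneg_right (hxh_le ({w, v₁, v₂} : Finset V) (subset_refl _)) hΛn
    linarith
  have hytop : yh ({w, v₁, v₂} : Finset V) * Λ - MY ≤ 0 := by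
    have h1 : y ({w, v₁, v₂} : Finset V) * Λ ≤ MY := by
      rw [hΛ, hMY, Finset.mul_sum]
      exact Finset.sum_le_sum fun Z hZ => mul_le_mul_of_nonneg_right
        (hyanti Z ({w, v₁, v₂} : Finset V) (Finset.mem_powerset.mp hZ) (subset_refl _)) (hμ Z hZ)
    have h2 : yh ({w, v₁, v₂} : Finset V) * Λ ≤ y ({w, v₁, v₂} : Finset V) * Λ :=
      mul_le_mul_of_nonneg_right (hyh_le ({w, v₁, v₂} : Finset V) (subset_refl _)) hΛn
    linarith
  -- BLOCK A: the non-pivotal family `𝒩_w`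
  have hA : 0 ≤ ∑ Z ∈ ({w, v₁, v₂} : Finset V).powerset.filter (fun Z => Disjoint Z {w}),
      μ Z * (xh Z * Λ - MX) * (yh Z * Λ - MY) := by
    refine block_nonneg _ μ xh yh Λ MX MY (fun Z hZ => hμ Z (Finset.mem_filter.mp hZ).1) ?_
      (Or.inl ⟨?_, ?_⟩)
    · exact hPA {w} (Finset.singleton_subset_iff.mpr hwP) _ _ monX monY nnX nnY
    · have h := shift_avoid_of_tracePA ({w, v₁, v₂} : Finset V) μ x hPA hx1 hxanti {w}
      rw [← hΛ, ← hMX] at h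
      have e : ∑ Z ∈ ({w, v₁, v₂} : Finset V).powerset.filter (fun Z => Disjoint Z {w}), xh Z * μ Z =
          ∑ Z ∈ ({w, v₁, v₂} : Finset V).powerset.filter (fun Z => Disjoint Z {w}), x Z * μ Z :=
        Finset.sum_congr rfl fun Z hZ => by
          rw [hxh_eq Z (Finset.mem_powerset.mp (Finset.mem_filter.mp hZ).1)
            (Finset.disjoint_singleton_right.mp (Finset.mem_filter.mp hZ).2)]
      rw [e]; exact h
    · have h := shift_avoid_of_tracePA ({w, v₁, v₂} : Finset V) μ y hPA hy1 hyanti {w}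
      rw [← hΛ, ← hMY] at h
      have e : ∑ Z ∈ ({w, v₁, v₂} : Finset V).powerset.filter (fun Z => Disjoint Z {w}), yh Z * μ Z =
          ∑ Z ∈ ({w, v₁, v₂} : Finset V).powerset.filter (fun Z => Disjoint Z {w}), y Z * μ Z :=
        Finset.sum_congr rfl fun Z hZ => by
          rw [hyh_eq Z (Finset.mem_powerset.mp (Finset.mem_filter.mp hZ).1)
            (Finset.disjoint_singleton_right.mp (Finset.mem_filter.mp hZ).2)]
      rw [e]; exact h
  -- BLOCK B: `𝒩_w ∪ {P}`
  have hB : 0 ≤ ∑ Z ∈ ({w, v₁, v₂} : Finset V).powerset.filter (fun Z => Disjoint Z {w} ∨ (v₁ ∈ Z ∧ v₂ ∈ Z)),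
      μ Z * (xh Z * Λ - MX) * (yh Z * Λ - MY) := by
    rw [← Finset.sum_filter_add_sum_filter_not _ (fun Z => Disjoint Z {w})]
    have e1 : (({w, v₁, v₂} : Finset V).powerset.filter (fun Z => Disjoint Z {w} ∨ (v₁ ∈ Z ∧ v₂ ∈ Z))).filter
        (fun Z => Disjoint Z {w}) = ({w, v₁, v₂} : Finset V).powerset.filter (fun Z => Disjoint Z {w}) := by
      rw [Finset.filter_filter]
      exact Finset.filter_congr fun Z _ => ⟨fun h => h.2, fun h => ⟨Or.inl h, h⟩⟩
    rw [e1]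
    refine add_nonneg hA (Finset.sum_nonneg fun Z hZ => ?_)
    rw [Finset.mem_filter, Finset.mem_filter, Finset.mem_powerset] at hZ
    obtain ⟨⟨hZP, hBZ⟩, hnA⟩ := hZ
    have hw : w ∈ Z := by
      by_contra h
      exact hnA (Finset.disjoint_singleton_right.mpr h)
    rcases hBZ with hA' | ⟨hv₁, hv₂⟩
    · exact absurd hA' hnA
    · have hZe : Z = ({w, v₁, v₂} : Finset V) := by
        ext z
        constructor
        · exact fun h => hZP h
        · intro h
          simp only [Finset.mem_insert, Finset.mem_singleton] at h
          rcases h with rfl | rfl | rfl <;> assumption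
      rw [hZe]
      exact mul_nonneg_of_nonpos_of_nonpos
        (mul_nonpos_of_nonneg_of_nonpos (hμ ({w, v₁, v₂} : Finset V) (Finset.mem_powerset_self _)) hxtop) hytop
  -- BLOCK C: `𝒩_{w v₂} ⊔ {Z ∋ v₂}`
  have hC : 0 ≤ ∑ Z ∈ ({w, v₁, v₂} : Finset V).powerset.filter (fun Z => Disjoint Z {w} ∨ v₂ ∈ Z),
      μ Z * (xh Z * Λ - MX) * (yh Z * Λ - MY) := by
    rw [← Finset.sum_filter_add_sum_filter_not _ (fun Z => v₂ ∈ Z)]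
    have e1 : (({w, v₁, v₂} : Finset V).powerset.filter (fun Z => Disjoint Z {w} ∨ v₂ ∈ Z)).filter (fun Z => v₂ ∈ Z) =
        ({w, v₁, v₂} : Finset V).powerset.filter (fun Z => v₂ ∈ Z) := by
      rw [Finset.filter_filter]
      exact Finset.filter_congr fun Z _ => ⟨fun h => h.2, fun h => ⟨Or.inr h, h⟩⟩
    have e2 : (({w, v₁, v₂} : Finset V).powerset.filter (fun Z => Disjoint Z {w} ∨ v₂ ∈ Z)).filter (fun Z => ¬ v₂ ∈ Z) =
        ({w, v₁, v₂} : Finset V).powerset.filter (fun Z => Disjoint Z {w, v₂}) := by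
      rw [Finset.filter_filter]
      refine Finset.filter_congr fun Z _ => ?_
      constructor
      · rintro ⟨h | h, hn⟩
        · exact Finset.disjoint_insert_right.mpr
            ⟨Finset.disjoint_singleton_right.mp h, Finset.disjoint_singleton_right.mpr hn⟩
        · exact absurd h hn
      · intro h
        obtain ⟨hw, hv⟩ := Finset.disjoint_insert_right.mp h
        exact ⟨Or.inl (Finset.disjoint_singleton_right.mpr hw),
          Finset.disjoint_singleton_right.mp hv⟩
    rw [e1, e2]
    refine add_nonneg ?_ ?_
    · -- the cylinder block at `v₂`
      refine block_nonneg _ μ xh yh Λ MX MY (fun Z hZ => hμ Z (Finset.mem_filter.mp hZ).1) ?_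
        (Or.inr ⟨?_, ?_⟩)
      · exact hCU _ _ monX monY nnX nnY
      · have h1 := shift_mem_of_tracePA ({w, v₁, v₂} : Finset V) μ x hPA hx1 hxanti v₂
        rw [← hΛ, ← hMX] at h1
        have h2 : ∑ Z ∈ ({w, v₁, v₂} : Finset V).powerset.filter (fun Z => v₂ ∈ Z), xh Z * μ Z ≤
            ∑ Z ∈ ({w, v₁, v₂} : Finset V).powerset.filter (fun Z => v₂ ∈ Z), x Z * μ Z :=
          Finset.sum_le_sum fun Z hZ => mul_le_mul_of_nonneg_right
            (hxh_le Z (Finset.mem_powerset.mp (Finset.mem_filter.mp hZ).1))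
            (hμ Z (Finset.mem_filter.mp hZ).1)
        exact (mul_le_mul_of_nonneg_right h2 hΛn).trans h1
      · have h1 := shift_mem_of_tracePA ({w, v₁, v₂} : Finset V) μ y hPA hy1 hyanti v₂
        rw [← hΛ, ← hMY] at h1
        have h2 : ∑ Z ∈ ({w, v₁, v₂} : Finset V).powerset.filter (fun Z => v₂ ∈ Z), yh Z * μ Z ≤
            ∑ Z ∈ ({w, v₁, v₂} : Finset V).powerset.filter (fun Z => v₂ ∈ Z), y Z * μ Z :=
          Finset.sum_le_sum fun Z hZ => mul_le_mul_of_nonneg_right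
            (hyh_le Z (Finset.mem_powerset.mp (Finset.mem_filter.mp hZ).1))
            (hμ Z (Finset.mem_filter.mp hZ).1)
        exact (mul_le_mul_of_nonneg_right h2 hΛn).trans h1
    · -- the avoidance block `𝒩_{w v₂}`
      refine block_nonneg _ μ xh yh Λ MX MY (fun Z hZ => hμ Z (Finset.mem_filter.mp hZ).1) ?_
        (Or.inl ⟨?_, ?_⟩)
      · exact hPA {w, v₂} (Finset.insert_subset hwP (Finset.singleton_subset_iff.mpr hv₂P)) _ _
          monX monY nnX nnY
      · have h := shift_avoid_of_tracePA ({w, v₁, v₂} : Finset V) μ x hPA hx1 hxanti {w, v₂}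
        rw [← hΛ, ← hMX] at h
        have e : ∑ Z ∈ ({w, v₁, v₂} : Finset V).powerset.filter (fun Z => Disjoint Z {w, v₂}), xh Z * μ Z =
            ∑ Z ∈ ({w, v₁, v₂} : Finset V).powerset.filter (fun Z => Disjoint Z {w, v₂}), x Z * μ Z :=
          Finset.sum_congr rfl fun Z hZ => by
            rw [hxh_eq Z (Finset.mem_powerset.mp (Finset.mem_filter.mp hZ).1)
              (Finset.disjoint_insert_right.mp (Finset.mem_filter.mp hZ).2).1]
        rw [e]; exact h
      · have h := shift_avoid_of_tracePA ({w, v₁, v₂} : Finset V) μ y hPA hy1 hyanti {w, v₂}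
        rw [← hΛ, ← hMY] at h
        have e : ∑ Z ∈ ({w, v₁, v₂} : Finset V).powerset.filter (fun Z => Disjoint Z {w, v₂}), yh Z * μ Z =
            ∑ Z ∈ ({w, v₁, v₂} : Finset V).powerset.filter (fun Z => Disjoint Z {w, v₂}), y Z * μ Z :=
          Finset.sum_congr rfl fun Z hZ => by
            rw [hyh_eq Z (Finset.mem_powerset.mp (Finset.mem_filter.mp hZ).1)
              (Finset.disjoint_insert_right.mp (Finset.mem_filter.mp hZ).2).1]
        rw [e]; exact h
  -- BLOCK D: the whole family with the pivotal data
  have hD : 0 ≤ ∑ Z ∈ ({w, v₁, v₂} : Finset V).powerset, μ Z * (xh Z * Λ - MX) * (yh Z * Λ - MY) := by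
    refine block_nonneg _ μ xh yh Λ MX MY hμ ?_ (Or.inr ⟨?_, ?_⟩)
    · have h := hPA ∅ (Finset.empty_subset _) _ _ monX monY nnX nnY
      simpa only [filter_disjoint_empty] using h
    · have h2 : ∑ Z ∈ ({w, v₁, v₂} : Finset V).powerset, xh Z * μ Z ≤ MX := by
        rw [hMX]
        exact Finset.sum_le_sum fun Z hZ => mul_le_mul_of_nonneg_right
          (hxh_le Z (Finset.mem_powerset.mp hZ)) (hμ Z hZ)
      rw [← hΛ]
      exact mul_le_mul_of_nonneg_right h2 hΛn
    · have h2 : ∑ Z ∈ ({w, v₁, v₂} : Finset V).powerset, yh Z * μ Z ≤ MY := by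
        rw [hMY]
        exact Finset.sum_le_sum fun Z hZ => mul_le_mul_of_nonneg_right
          (hyh_le Z (Finset.mem_powerset.mp hZ)) (hμ Z hZ)
      rw [← hΛ]
      exact mul_le_mul_of_nonneg_right h2 hΛn
  -- ABEL: `S′ = (1 − r)·A + (r − r₂)·B + (r₂ − r₁)·C + r₁·D`
  have hdec : ∑ Z ∈ ({w, v₁, v₂} : Finset V).powerset, μ Z * ρ Z * (xh Z * Λ - MX) * (yh Z * Λ - MY) =
      (1 - ρ ({w, v₁, v₂} : Finset V)) * ∑ Z ∈ ({w, v₁, v₂} : Finset V).powerset.filter (fun Z => Disjoint Z {w}),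
          μ Z * (xh Z * Λ - MX) * (yh Z * Λ - MY)
      + (ρ ({w, v₁, v₂} : Finset V) - ρ {w, v₂}) *
          ∑ Z ∈ ({w, v₁, v₂} : Finset V).powerset.filter (fun Z => Disjoint Z {w} ∨ (v₁ ∈ Z ∧ v₂ ∈ Z)),
            μ Z * (xh Z * Λ - MX) * (yh Z * Λ - MY)
      + (ρ {w, v₂} - ρ {w, v₁}) *
          ∑ Z ∈ ({w, v₁, v₂} : Finset V).powerset.filter (fun Z => Disjoint Z {w} ∨ v₂ ∈ Z),
            μ Z * (xh Z * Λ - MX) * (yh Z * Λ - MY)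
      + ρ {w, v₁} * ∑ Z ∈ ({w, v₁, v₂} : Finset V).powerset, μ Z * (xh Z * Λ - MX) * (yh Z * Λ - MY) := by
    have e : ∀ Z ∈ ({w, v₁, v₂} : Finset V).powerset, μ Z * ρ Z * (xh Z * Λ - MX) * (yh Z * Λ - MY) =
        (1 - ρ ({w, v₁, v₂} : Finset V)) * ((if Disjoint Z {w} then (1 : R) else 0) *
            (μ Z * (xh Z * Λ - MX) * (yh Z * Λ - MY)))
        + (ρ ({w, v₁, v₂} : Finset V) - ρ {w, v₂}) * ((if Disjoint Z {w} ∨ (v₁ ∈ Z ∧ v₂ ∈ Z) then (1 : R) else 0) *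
            (μ Z * (xh Z * Λ - MX) * (yh Z * Λ - MY)))
        + (ρ {w, v₂} - ρ {w, v₁}) * ((if Disjoint Z {w} ∨ v₂ ∈ Z then (1 : R) else 0) *
            (μ Z * (xh Z * Λ - MX) * (yh Z * Λ - MY)))
        + ρ {w, v₁} * (μ Z * (xh Z * Λ - MX) * (yh Z * Λ - MY)) := by
      intro Z hZ
      have hd := twoStar_rho_decomp hwv₁ hwv₂ hv₁₂ μ ρ hμw hρ1 hZ
      rw [show μ Z * ρ Z * (xh Z * Λ - MX) * (yh Z * Λ - MY) =
        (μ Z * ρ Z) * ((xh Z * Λ - MX) * (yh Z * Λ - MY)) by ring, hd]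
      ring
    rw [Finset.sum_congr rfl e, Finset.sum_add_distrib, Finset.sum_add_distrib,
      Finset.sum_add_distrib, ← Finset.mul_sum, ← Finset.mul_sum, ← Finset.mul_sum,
      ← Finset.mul_sum, sum_ite_mul_eq_sum_filter, sum_ite_mul_eq_sum_filter,
      sum_ite_mul_eq_sum_filter]
  rw [hdec]
  have h1 : 0 ≤ 1 - ρ ({w, v₁, v₂} : Finset V) := by linarith
  have h2 : 0 ≤ ρ ({w, v₁, v₂} : Finset V) - ρ {w, v₂} := by linarith
  have h3 : 0 ≤ ρ {w, v₂} - ρ {w, v₁} := by linarith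
  exact add_nonneg (add_nonneg (add_nonneg (mul_nonneg h1 hA) (mul_nonneg h2 hB))
    (mul_nonneg h3 hC)) (mul_nonneg hρ0 hD)


/-- **The abstract pendant lemma for the 2-star family** (NIGHT2-DARC.md §15.8 in the kernel):
`S′ = Σ_Z μ_Z ρ_Z (x̂_Z Λ − MX)(ŷ_Z Λ − MY) ≥ 0` for every trace law on `2^{w, v₁, v₂}` with
`μ {w} = 0` satisfying (AV-PA) and (CU-PA) at both leaves, decreasing data `x, y, x̂, ŷ ≤ 1` with
`x̂ ≤ x`, `x̂ = x` off the pivotal family, and pivotal weights `ρ ∈ [0, 1]`, `= 1` off the pivotal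
family, increasing from `{w, vᵢ}` to the top. -/
theorem twoStar_functional_nonneg {w v₁ v₂ : V} (hwv₁ : w ≠ v₁) (hwv₂ : w ≠ v₂) (hv₁₂ : v₁ ≠ v₂)
    (μ x y xh yh ρ : Finset V → R)
    (hμ : ∀ Z ∈ ({w, v₁, v₂} : Finset V).powerset, 0 ≤ μ Z) (hμw : μ {w} = 0)
    (hx1 : ∀ Z : Finset V, Z ⊆ ({w, v₁, v₂} : Finset V) → x Z ≤ 1) (hy1 : ∀ Z : Finset V, Z ⊆ ({w, v₁, v₂} : Finset V) → y Z ≤ 1)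
    (hxh1 : ∀ Z : Finset V, Z ⊆ ({w, v₁, v₂} : Finset V) → xh Z ≤ 1) (hyh1 : ∀ Z : Finset V, Z ⊆ ({w, v₁, v₂} : Finset V) → yh Z ≤ 1)
    (hxanti : ∀ Z Z' : Finset V, Z ⊆ Z' → Z' ⊆ ({w, v₁, v₂} : Finset V) → x Z' ≤ x Z)
    (hyanti : ∀ Z Z' : Finset V, Z ⊆ Z' → Z' ⊆ ({w, v₁, v₂} : Finset V) → y Z' ≤ y Z)
    (hxhanti : ∀ Z Z' : Finset V, Z ⊆ Z' → Z' ⊆ ({w, v₁, v₂} : Finset V) → xh Z' ≤ xh Z)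
    (hyhanti : ∀ Z Z' : Finset V, Z ⊆ Z' → Z' ⊆ ({w, v₁, v₂} : Finset V) → yh Z' ≤ yh Z)
    (hxh_le : ∀ Z : Finset V, Z ⊆ ({w, v₁, v₂} : Finset V) → xh Z ≤ x Z) (hyh_le : ∀ Z : Finset V, Z ⊆ ({w, v₁, v₂} : Finset V) → yh Z ≤ y Z)
    (hxh_eq : ∀ Z : Finset V, Z ⊆ ({w, v₁, v₂} : Finset V) → w ∉ Z → xh Z = x Z)
    (hyh_eq : ∀ Z : Finset V, Z ⊆ ({w, v₁, v₂} : Finset V) → w ∉ Z → yh Z = y Z)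
    (hρ1 : ∀ Z ∈ ({w, v₁, v₂} : Finset V).powerset, w ∉ Z → ρ Z = 1) (hρ0 : ∀ Z ∈ ({w, v₁, v₂} : Finset V).powerset, 0 ≤ ρ Z)
    (hρle : ρ ({w, v₁, v₂} : Finset V) ≤ 1) (hρ₁ : ρ {w, v₁} ≤ ρ ({w, v₁, v₂} : Finset V)) (hρ₂ : ρ {w, v₂} ≤ ρ ({w, v₁, v₂} : Finset V))
    (hPA : TracePA ({w, v₁, v₂} : Finset V) μ) (hCU₁ : TraceCUPA ({w, v₁, v₂} : Finset V) μ v₁) (hCU₂ : TraceCUPA ({w, v₁, v₂} : Finset V) μ v₂) :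
    0 ≤ ∑ Z ∈ ({w, v₁, v₂} : Finset V).powerset, μ Z * ρ Z *
      (xh Z * (∑ Z' ∈ ({w, v₁, v₂} : Finset V).powerset, μ Z') - ∑ Z' ∈ ({w, v₁, v₂} : Finset V).powerset, x Z' * μ Z') *
      (yh Z * (∑ Z' ∈ ({w, v₁, v₂} : Finset V).powerset, μ Z') - ∑ Z' ∈ ({w, v₁, v₂} : Finset V).powerset, y Z' * μ Z') := by
  rcases le_total (ρ {w, v₁}) (ρ {w, v₂}) with hr | hr
  · exact twoStar_core hwv₁ hwv₂ hv₁₂ μ x y xh yh ρ hμ hμw hx1 hy1 hxh1 hyh1 hxanti hyanti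
      hxhanti hyhanti hxh_le hyh_le hxh_eq hyh_eq hρ1
      (hρ0 _ (Finset.mem_powerset.mpr (by simp [Finset.insert_subset_iff]))) hρle hρ₂ hr hPA hCU₂
  · have hPeq : ({w, v₁, v₂} : Finset V) = ({w, v₂, v₁} : Finset V) := by
      show insert w ({v₁, v₂} : Finset V) = insert w {v₂, v₁}
      rw [Finset.pair_comm]
    have h := twoStar_core hwv₂ hwv₁ hv₁₂.symm μ x y xh yh ρ (by rw [← hPeq]; exact hμ) hμw
      (by rw [← hPeq]; exact hx1) (by rw [← hPeq]; exact hy1) (by rw [← hPeq]; exact hxh1)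
      (by rw [← hPeq]; exact hyh1) (by rw [← hPeq]; exact hxanti) (by rw [← hPeq]; exact hyanti)
      (by rw [← hPeq]; exact hxhanti) (by rw [← hPeq]; exact hyhanti)
      (by rw [← hPeq]; exact hxh_le) (by rw [← hPeq]; exact hyh_le)
      (by rw [← hPeq]; exact hxh_eq) (by rw [← hPeq]; exact hyh_eq) (by rw [← hPeq]; exact hρ1)
      (hρ0 _ (Finset.mem_powerset.mpr (by simp [Finset.insert_subset_iff])))
      (by rw [← hPeq]; exact hρle) (by rw [← hPeq]; exact hρ₁) hr (by rw [← hPeq]; exact hPA)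
      (by rw [← hPeq]; exact hCU₁)
    rw [← hPeq] at h
    exact h

end TwoStar

end Summit.Ventures.PercRepro2.Coin
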